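import Summits.CriticalPhenomena.PercolationContinuityZ3.Theorems.PercNearOneGluingNoHeavyLowerTailThreePointProductFormCorners

/-!
# THEOREM C — the 255 corner values of length ≤ 7 (exact evaluation of the trace form `tval`)
# (Sahi programme, prover prim-sahi-p2 gen 65; companion of `…ThreePointProductFormCorners`)

Support file (`--supports stmt-CriticalPhenomena-4575`).  `0 ≤ tval w` for every sign pattern `w` with `|w| ≤ 7`, by `norm_num`
evaluation of the 3-dimensional word action (≤ 16 evaluations per declaration).  These are the words not covered by the length-8
suffix certificates of `…ProductFormCornersCert*`.  [this work] (gen 65).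
-/

namespace Summit.CriticalPhenomena.PercolationContinuityZ3.Theorems.ProductFormCorners

/-! ## Words of length at most 7 (exact evaluation; ≤ 16 evaluations per declaration) -/

/-- `0 ≤ tval w` for `|w| ≤ 3`. [this work] -/
theorem tval_small3 (w : List Bool) (hw : w.length ≤ 3) : 0 ≤ tval w := by
  match w, hw with
  | [], _ => norm_num [tval, dot, iter, step, mP, mM, e1, e2, e3, om1, om2, om3]
  | [b1], _ => cases b1 <;> norm_num [tval, dot, iter, step, mP, mM, e1, e2, e3, om1, om2, om3]
  | [b1, b2], _ => cases b1 <;> cases b2 <;> norm_num [tval, dot, iter, step, mP, mM, e1, e2, e3, om1, om2, om3]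
  | [b1, b2, b3], _ => cases b1 <;> cases b2 <;> cases b3 <;> norm_num [tval, dot, iter, step, mP, mM, e1, e2, e3, om1, om2, om3]
  | _ :: _ :: _ :: _ :: _, h => simp at h

/-- `0 ≤ tval w` for `|w| = 4`. [this work] -/
theorem tval_small4 (b1 b2 b3 b4 : Bool) : 0 ≤ tval [b1, b2, b3, b4] := by
  cases b1 <;> cases b2 <;> cases b3 <;> cases b4 <;> norm_num [tval, dot, iter, step, mP, mM, e1, e2, e3, om1, om2, om3]

/-- `0 ≤ tval w` for `|w| = 5`, first letter `true`. [this work] -/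
theorem tval_small5_t (b2 b3 b4 b5 : Bool) : 0 ≤ tval [true, b2, b3, b4, b5] := by
  cases b2 <;> cases b3 <;> cases b4 <;> cases b5 <;> norm_num [tval, dot, iter, step, mP, mM, e1, e2, e3, om1, om2, om3]

/-- `0 ≤ tval w` for `|w| = 5`, first letter `false`. [this work] -/
theorem tval_small5_f (b2 b3 b4 b5 : Bool) : 0 ≤ tval [false, b2, b3, b4, b5] := by
  cases b2 <;> cases b3 <;> cases b4 <;> cases b5 <;> norm_num [tval, dot, iter, step, mP, mM, e1, e2, e3, om1, om2, om3]

/-- `0 ≤ tval w` for `|w| = 6`, first letters `true, true`. [this work] -/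
theorem tval_small6_tt (b3 b4 b5 b6 : Bool) : 0 ≤ tval [true, true, b3, b4, b5, b6] := by
  cases b3 <;> cases b4 <;> cases b5 <;> cases b6 <;> norm_num [tval, dot, iter, step, mP, mM, e1, e2, e3, om1, om2, om3]

/-- `0 ≤ tval w` for `|w| = 6`, first letters `true, false`. [this work] -/
theorem tval_small6_tf (b3 b4 b5 b6 : Bool) : 0 ≤ tval [true, false, b3, b4, b5, b6] := by
  cases b3 <;> cases b4 <;> cases b5 <;> cases b6 <;> norm_num [tval, dot, iter, step, mP, mM, e1, e2, e3, om1, om2, om3]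

/-- `0 ≤ tval w` for `|w| = 6`, first letters `false, true`. [this work] -/
theorem tval_small6_ft (b3 b4 b5 b6 : Bool) : 0 ≤ tval [false, true, b3, b4, b5, b6] := by
  cases b3 <;> cases b4 <;> cases b5 <;> cases b6 <;> norm_num [tval, dot, iter, step, mP, mM, e1, e2, e3, om1, om2, om3]

/-- `0 ≤ tval w` for `|w| = 6`, first letters `false, false`. [this work] -/
theorem tval_small6_ff (b3 b4 b5 b6 : Bool) : 0 ≤ tval [false, false, b3, b4, b5, b6] := by
  cases b3 <;> cases b4 <;> cases b5 <;> cases b6 <;> norm_num [tval, dot, iter, step, mP, mM, e1, e2, e3, om1, om2, om3]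

/-- `0 ≤ tval w` for `|w| = 7`, first letters `true, true, true, true`. [this work] -/
theorem tval_small7_tttt (b5 b6 b7 : Bool) : 0 ≤ tval [true, true, true, true, b5, b6, b7] := by
  cases b5 <;> cases b6 <;> cases b7 <;> norm_num [tval, dot, iter, step, mP, mM, e1, e2, e3, om1, om2, om3]

/-- `0 ≤ tval w` for `|w| = 7`, first letters `true, true, true, false`. [this work] -/
theorem tval_small7_tttf (b5 b6 b7 : Bool) : 0 ≤ tval [true, true, true, false, b5, b6, b7] := by
  cases b5 <;> cases b6 <;> cases b7 <;> norm_num [tval, dot, iter, step, mP, mM, e1, e2, e3, om1, om2, om3]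

/-- `0 ≤ tval w` for `|w| = 7`, first letters `true, true, false, true`. [this work] -/
theorem tval_small7_ttft (b5 b6 b7 : Bool) : 0 ≤ tval [true, true, false, true, b5, b6, b7] := by
  cases b5 <;> cases b6 <;> cases b7 <;> norm_num [tval, dot, iter, step, mP, mM, e1, e2, e3, om1, om2, om3]

/-- `0 ≤ tval w` for `|w| = 7`, first letters `true, true, false, false`. [this work] -/
theorem tval_small7_ttff (b5 b6 b7 : Bool) : 0 ≤ tval [true, true, false, false, b5, b6, b7] := by
  cases b5 <;> cases b6 <;> cases b7 <;> norm_num [tval, dot, iter, step, mP, mM, e1, e2, e3, om1, om2, om3]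

/-- `0 ≤ tval w` for `|w| = 7`, first letters `true, false, true, true`. [this work] -/
theorem tval_small7_tftt (b5 b6 b7 : Bool) : 0 ≤ tval [true, false, true, true, b5, b6, b7] := by
  cases b5 <;> cases b6 <;> cases b7 <;> norm_num [tval, dot, iter, step, mP, mM, e1, e2, e3, om1, om2, om3]

/-- `0 ≤ tval w` for `|w| = 7`, first letters `true, false, true, false`. [this work] -/
theorem tval_small7_tftf (b5 b6 b7 : Bool) : 0 ≤ tval [true, false, true, false, b5, b6, b7] := by
  cases b5 <;> cases b6 <;> cases b7 <;> norm_num [tval, dot, iter, step, mP, mM, e1, e2, e3, om1, om2, om3]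

/-- `0 ≤ tval w` for `|w| = 7`, first letters `true, false, false, true`. [this work] -/
theorem tval_small7_tfft (b5 b6 b7 : Bool) : 0 ≤ tval [true, false, false, true, b5, b6, b7] := by
  cases b5 <;> cases b6 <;> cases b7 <;> norm_num [tval, dot, iter, step, mP, mM, e1, e2, e3, om1, om2, om3]

/-- `0 ≤ tval w` for `|w| = 7`, first letters `true, false, false, false`. [this work] -/
theorem tval_small7_tfff (b5 b6 b7 : Bool) : 0 ≤ tval [true, false, false, false, b5, b6, b7] := by
  cases b5 <;> cases b6 <;> cases b7 <;> norm_num [tval, dot, iter, step, mP, mM, e1, e2, e3, om1, om2, om3]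

/-- `0 ≤ tval w` for `|w| = 7`, first letters `false, true, true, true`. [this work] -/
theorem tval_small7_fttt (b5 b6 b7 : Bool) : 0 ≤ tval [false, true, true, true, b5, b6, b7] := by
  cases b5 <;> cases b6 <;> cases b7 <;> norm_num [tval, dot, iter, step, mP, mM, e1, e2, e3, om1, om2, om3]

/-- `0 ≤ tval w` for `|w| = 7`, first letters `false, true, true, false`. [this work] -/
theorem tval_small7_fttf (b5 b6 b7 : Bool) : 0 ≤ tval [false, true, true, false, b5, b6, b7] := by
  cases b5 <;> cases b6 <;> cases b7 <;> norm_num [tval, dot, iter, step, mP, mM, e1, e2, e3, om1, om2, om3]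

/-- `0 ≤ tval w` for `|w| = 7`, first letters `false, true, false, true`. [this work] -/
theorem tval_small7_ftft (b5 b6 b7 : Bool) : 0 ≤ tval [false, true, false, true, b5, b6, b7] := by
  cases b5 <;> cases b6 <;> cases b7 <;> norm_num [tval, dot, iter, step, mP, mM, e1, e2, e3, om1, om2, om3]

/-- `0 ≤ tval w` for `|w| = 7`, first letters `false, true, false, false`. [this work] -/
theorem tval_small7_ftff (b5 b6 b7 : Bool) : 0 ≤ tval [false, true, false, false, b5, b6, b7] := by
  cases b5 <;> cases b6 <;> cases b7 <;> norm_num [tval, dot, iter, step, mP, mM, e1, e2, e3, om1, om2, om3]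

/-- `0 ≤ tval w` for `|w| = 7`, first letters `false, false, true, true`. [this work] -/
theorem tval_small7_fftt (b5 b6 b7 : Bool) : 0 ≤ tval [false, false, true, true, b5, b6, b7] := by
  cases b5 <;> cases b6 <;> cases b7 <;> norm_num [tval, dot, iter, step, mP, mM, e1, e2, e3, om1, om2, om3]

/-- `0 ≤ tval w` for `|w| = 7`, first letters `false, false, true, false`. [this work] -/
theorem tval_small7_fftf (b5 b6 b7 : Bool) : 0 ≤ tval [false, false, true, false, b5, b6, b7] := by
  cases b5 <;> cases b6 <;> cases b7 <;> norm_num [tval, dot, iter, step, mP, mM, e1, e2, e3, om1, om2, om3]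

/-- `0 ≤ tval w` for `|w| = 7`, first letters `false, false, false, true`. [this work] -/
theorem tval_small7_ffft (b5 b6 b7 : Bool) : 0 ≤ tval [false, false, false, true, b5, b6, b7] := by
  cases b5 <;> cases b6 <;> cases b7 <;> norm_num [tval, dot, iter, step, mP, mM, e1, e2, e3, om1, om2, om3]

/-- `0 ≤ tval w` for `|w| = 7`, first letters `false, false, false, false`. [this work] -/
theorem tval_small7_ffff (b5 b6 b7 : Bool) : 0 ≤ tval [false, false, false, false, b5, b6, b7] := by
  cases b5 <;> cases b6 <;> cases b7 <;> norm_num [tval, dot, iter, step, mP, mM, e1, e2, e3, om1, om2, om3]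

/-- `0 ≤ tval w` for all 255 sign patterns of length `≤ 7` (the corner values `0; 3; 4,16; 17,17,22,69; …`). [this work] -/
theorem tval_small (w : List Bool) (hw : w.length ≤ 7) : 0 ≤ tval w := by
  match w, hw with
  | [], _ => exact tval_small3 [] (by simp)
  | [b1], _ => exact tval_small3 [b1] (by simp)
  | [b1, b2], _ => exact tval_small3 [b1, b2] (by simp)
  | [b1, b2, b3], _ => exact tval_small3 [b1, b2, b3] (by simp)
  | [b1, b2, b3, b4], _ => exact tval_small4 b1 b2 b3 b4
  | [b1, b2, b3, b4, b5], _ =>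
      cases b1
      · exact tval_small5_f b2 b3 b4 b5
      · exact tval_small5_t b2 b3 b4 b5
  | [b1, b2, b3, b4, b5, b6], _ =>
      cases b1 <;> cases b2
      · exact tval_small6_ff b3 b4 b5 b6
      · exact tval_small6_ft b3 b4 b5 b6
      · exact tval_small6_tf b3 b4 b5 b6
      · exact tval_small6_tt b3 b4 b5 b6
  | [b1, b2, b3, b4, b5, b6, b7], _ =>
      cases b1 <;> cases b2 <;> cases b3 <;> cases b4
      · exact tval_small7_ffff b5 b6 b7
      · exact tval_small7_ffft b5 b6 b7
      · exact tval_small7_fftf b5 b6 b7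
      · exact tval_small7_fftt b5 b6 b7
      · exact tval_small7_ftff b5 b6 b7
      · exact tval_small7_ftft b5 b6 b7
      · exact tval_small7_fttf b5 b6 b7
      · exact tval_small7_fttt b5 b6 b7
      · exact tval_small7_tfff b5 b6 b7
      · exact tval_small7_tfft b5 b6 b7
      · exact tval_small7_tftf b5 b6 b7
      · exact tval_small7_tftt b5 b6 b7
      · exact tval_small7_ttff b5 b6 b7
      · exact tval_small7_ttft b5 b6 b7
      · exact tval_small7_tttf b5 b6 b7
      · exact tval_small7_tttt b5 b6 b7
  | _ :: _ :: _ :: _ :: _ :: _ :: _ :: _ :: _, h => simp at h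

end Summit.CriticalPhenomena.PercolationContinuityZ3.Theorems.ProductFormCorners
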